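import Literature.NumberTheory.Weil1964.AdelicThetaDistribution
import Mathlib.Analysis.Fourier.FourierTransformDeriv
import HarnessLib

/-!
# Second-degree characters on `𝔸_Fⁿ` and Weil's operators `t(σ)` in the concrete adelic model

Origin: `pub-hodgecm` MODEL-CONSTRUCTION sub-cell, node **W5** (theta distribution / theta kernel), file F2
(construction prover `mc-theta-1`).  KERNEL MATHEMATICS ONLY: no `def … : Prop` records, no `axiom`, no
`sorry`; every `[cite: …]` / `[folklore]` tag below is provenance for a kernel-checked statement.

Continuing `AdelicThetaDistribution.lean` (the theta distribution `Θ(Φ) = Σ_{ξ ∈ Fⁿ} Φ(ξ)` on the tree's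
adelic Schwartz–Bruhat space `𝒮(𝔸_Fⁿ) = piSchwartzBruhat F (Fin n)` and its stabiliser `thetaStabilizer`),
this file constructs the second family of generators of Weil's pseudosymplectic group acting in the
Schrödinger model — the multiplication operators by CHARACTERS OF THE SECOND DEGREE
([Weil1964, Chap. I n° 2 p. 146], the operators `t(f)` of [Weil1964, Chap. I n° 34 p. 184]) — and proves
that their rational points stabilise `Θ` (the corresponding case of [Weil1964, Chap. III n° 41, (39) and
Thm 6 p. 193]: `Θ(r_k(s)Φ) = Θ(Φ)` for `s ∈ Ps(X)_k`).

* `hasTemperateGrowth_fourierChar_coe` — `s ↦ 𝐞(s) = exp(2πi s) : ℝ → ℂ` has temperate growth (all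
  derivatives bounded, `iteratedDeriv_fourierChar_coe`);
* ARCHIMEDEAN PART: for `T ∈ M_n(F ⊗ ℝ)` the second-degree form `archSdForm T a = ⟨a, aT⟩` (trace pairing
  `piTracePairing` of the tree) has temperate growth (`hasTemperateGrowth_archSdForm`, via the continuous
  bilinear packaging `piTracePairingCLM`), hence so does the character `archSdChar T = 𝐞(-⟨a, aT⟩)`, and
  **`archSdCharCLM T : 𝓢((F ⊗ ℝ)ⁿ, ℂ) →L[ℂ] 𝓢((F ⊗ ℝ)ⁿ, ℂ)`** is Mathlib's `SchwartzMap.smulLeftCLM`;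
* FINITE PART: `ψ_f` is locally constant (`isLocallyConstant_finiteAdeleAddChar`: it is trivial on the open
  subring `𝒪̂_F`), so `finSdChar T = ψ_f((bT)·b)` is locally constant and multiplication by it preserves the
  Schwartz–Bruhat space of `(𝔸_F^∞)ⁿ` (`finSdChar_mul_mem_schwartzBruhat`);
* GLOBAL: `sdForm S x = (xS)·x`, **`sdChar F S x = ψ_F((xS)·x)`** (`S ∈ M_n(𝔸_F)`), its splitting
  `sdChar_eq_mul` along `𝔸_Fⁿ ≅ (F ⊗ ℝ)ⁿ × (𝔸_F^∞)ⁿ` (the tree's `adeleAddChar_sum_mul_piAdeleSplit`), the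
  operators **`chirp F S Φ = sdChar F S · Φ`**, **`chirp_mem`** (`𝒮(𝔸_Fⁿ)` is stable), the packaged
  `chirpLM`, the one-parameter law `chirpLM_add` and the homomorphisms `chirpRep`, `chirpUnit` from the
  additive group `M_n(𝔸_F)` into the (invertible) linear operators of `𝒮(𝔸_Fⁿ)`;
* WEIL'S RELATION `d(g)⁻¹ t(S) d(g) = t(g S gᵀ)` with the twists of F1: `twist_chirp`;
* RATIONALITY: `sdChar_ratMatrix_ratPt` (`ψ_F` is trivial on `F`), **`thetaDist_chirp_ratMatrix`**
  (`Θ(t(σ)Φ) = Θ(Φ)` for `σ ∈ M_n(F)` and EVERY `Φ`), and **`chirpUnit_ratMatrix_mem_thetaStabilizer`**: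
  the rational second-degree characters lie in `thetaStabilizer F (Fin n)`, i.e. in the `rat` of the concrete
  `WeilThetaDatum` of F1 — the `t(σ)`-case of the invariance half of Théorème 6, proved.

## References

* [Weil1964] A. Weil, *Sur certains groupes d'opérateurs unitaires*, Acta Math. 111 (1964) 143–211, Chap. I
  n° 2 (caractères du second degré) p. 146, n° 34 p. 184, Chap. III n° 41 (39) and Thm 6 p. 193.
* [CasselsFrohlichANT1967] J. Tate, Fourier analysis in number fields …, in Cassels–Fröhlich (eds.),
  *Algebraic Number Theory* (1967), Ch. XV §2.2, §4.1 (the standard character `ψ = ψ_∞ ⊗ ψ_f`).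
-/

set_option autoImplicit false

noncomputable section

open scoped BigOperators NNReal Matrix Topology FourierTransform SchwartzMap Classical
open NumberField NumberField.mixedEmbedding IsDedekindDomain

namespace Literature.NumberTheory.Weil1964

open Literature.NumberTheory.Automorphic

/-! ### `s ↦ exp(2πi s)` has temperate growth -/

section FourierChar

/-- `𝐞(s) = exp(2πi s)` as a complex number. [folklore] -/
theorem fourierChar_coe_eq_exp (s : ℝ) :
    ((𝐞 s : Circle) : ℂ) = Complex.exp (2 * Real.pi * Complex.I * (s : ℂ)) := by
  rw [Real.fourierChar_apply]
  push_cast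
  ring_nf

/-- `s ↦ 𝐞(s)` is smooth. [folklore] -/
theorem contDiff_fourierChar_coe {m : WithTop ℕ∞} : ContDiff ℝ m (fun s : ℝ => ((𝐞 s : Circle) : ℂ)) := by
  have h : (fun s : ℝ => ((𝐞 s : Circle) : ℂ)) = fun s : ℝ => Complex.exp (2 * Real.pi * Complex.I * (s : ℂ)) :=
    funext fourierChar_coe_eq_exp
  rw [h]
  exact Complex.contDiff_exp.comp (contDiff_const.mul Complex.ofRealCLM.contDiff)

/-- `dᵏ/dsᵏ 𝐞(s) = (2πi)ᵏ 𝐞(s)`. [folklore] -/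
theorem iteratedDeriv_fourierChar_coe (k : ℕ) :
    iteratedDeriv k (fun s : ℝ => ((𝐞 s : Circle) : ℂ)) =
      fun s => (2 * Real.pi * Complex.I) ^ k * ((𝐞 s : Circle) : ℂ) := by
  induction k with
  | zero =>
    funext s
    rw [iteratedDeriv_zero, pow_zero, one_mul]
  | succ k ih =>
    rw [iteratedDeriv_succ, ih]
    funext s
    rw [((Real.hasDerivAt_fourierChar s).const_mul ((2 * Real.pi * Complex.I) ^ k)).deriv, pow_succ]
    ring

/-- `‖2πi‖ = 2π`. [folklore] -/
theorem norm_two_pi_mul_I : ‖(2 * Real.pi * Complex.I : ℂ)‖ = 2 * Real.pi := by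
  simp [abs_of_pos Real.pi_pos]

/-- **`s ↦ 𝐞(s) = exp(2πi s)` has temperate growth** (all its derivatives are bounded by `(2π)ᵏ`). [folklore] -/
theorem hasTemperateGrowth_fourierChar_coe :
    Function.HasTemperateGrowth (fun s : ℝ => ((𝐞 s : Circle) : ℂ)) := by
  refine ⟨contDiff_fourierChar_coe, fun k => ⟨0, (2 * Real.pi) ^ k, fun s => ?_⟩⟩
  rw [norm_iteratedFDeriv_eq_norm_iteratedDeriv, iteratedDeriv_fourierChar_coe, norm_mul, norm_pow,
    norm_two_pi_mul_I, Circle.norm_coe, mul_one, pow_zero, mul_one]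

end FourierChar

/-! ### The archimedean second-degree characters `a ↦ 𝐞(-⟨a, aT⟩)` on `(F ⊗ ℝ)ⁿ` -/

section Archimedean

variable (F : Type) [Field F] [NumberField F] (n : ℕ)

/-- The trace pairing `⟨a, w⟩ = Σ_i Tr(a_i w_i)` of `(F ⊗ ℝ)ⁿ` (the tree's `piTracePairing`) as a continuous
bilinear map (finite dimension). [folklore] -/
def piTracePairingCLM : (Fin n → mixedSpace F) →L[ℝ] (Fin n → mixedSpace F) →L[ℝ] ℝ :=
  LinearMap.toContinuousLinearMap
    ((LinearMap.toContinuousLinearMap :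
        ((Fin n → mixedSpace F) →ₗ[ℝ] ℝ) ≃ₗ[ℝ] ((Fin n → mixedSpace F) →L[ℝ] ℝ)).toLinearMap ∘ₗ
      piTracePairing F (Fin n))

variable {F n}

/-- Unfolding of `piTracePairingCLM`. [folklore] -/
@[simp] theorem piTracePairingCLM_apply (a w : Fin n → mixedSpace F) :
    piTracePairingCLM F n a w = piTracePairing F (Fin n) a w := rfl

variable (F) in
/-- `a ↦ aT` on `(F ⊗ ℝ)ⁿ` (`T ∈ M_n(F ⊗ ℝ)`) as a continuous `ℝ`-linear map. [folklore] -/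
def vecMulArchCLM (T : Matrix (Fin n) (Fin n) (mixedSpace F)) :
    (Fin n → mixedSpace F) →L[ℝ] (Fin n → mixedSpace F) :=
  LinearMap.toContinuousLinearMap ((Matrix.vecMulLinear T).restrictScalars ℝ)

/-- Unfolding of `vecMulArchCLM`. [folklore] -/
@[simp] theorem vecMulArchCLM_apply (T : Matrix (Fin n) (Fin n) (mixedSpace F)) (a : Fin n → mixedSpace F) :
    vecMulArchCLM F T a = a ᵥ* T := rfl

variable (F) in
/-- The archimedean **second-degree form** `q_T(a) = ⟨a, aT⟩ = Σ_i Tr(a_i (aT)_i)` of `T ∈ M_n(F ⊗ ℝ)`.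
[folklore] -/
def archSdForm (T : Matrix (Fin n) (Fin n) (mixedSpace F)) (a : Fin n → mixedSpace F) : ℝ :=
  piTracePairing F (Fin n) a (a ᵥ* T)

/-- Unfolding of `archSdForm`. [folklore] -/
theorem archSdForm_apply (T : Matrix (Fin n) (Fin n) (mixedSpace F)) (a : Fin n → mixedSpace F) :
    archSdForm F T a = piTracePairing F (Fin n) a (a ᵥ* T) := rfl

/-- A quadratic form on a finite-dimensional space has temperate growth. [folklore] -/
theorem hasTemperateGrowth_archSdForm (T : Matrix (Fin n) (Fin n) (mixedSpace F)) :
    (archSdForm F T).HasTemperateGrowth :=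
  (piTracePairingCLM F n).bilinear_hasTemperateGrowth Function.HasTemperateGrowth.id'
    (vecMulArchCLM F T).hasTemperateGrowth

variable (F) in
/-- The archimedean **second-degree character** `a ↦ 𝐞(-q_T(a)) = exp(-2πi Σ_i Tr(a_i (aT)_i))` (the sign is
Tate's: `ψ_∞(y) = exp(-2πi Tr y)`, `adeleAddChar_infiniteAdeleInl`). [folklore] -/
def archSdChar (T : Matrix (Fin n) (Fin n) (mixedSpace F)) (a : Fin n → mixedSpace F) : ℂ :=
  ((𝐞 (-(archSdForm F T a)) : Circle) : ℂ)

/-- Unfolding of `archSdChar`. [folklore] -/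
theorem archSdChar_apply (T : Matrix (Fin n) (Fin n) (mixedSpace F)) (a : Fin n → mixedSpace F) :
    archSdChar F T a = ((𝐞 (-(piTracePairing F (Fin n) a (a ᵥ* T))) : Circle) : ℂ) := rfl

/-- **The archimedean second-degree characters have temperate growth.** [folklore] -/
theorem hasTemperateGrowth_archSdChar (T : Matrix (Fin n) (Fin n) (mixedSpace F)) :
    (archSdChar F T).HasTemperateGrowth :=
  hasTemperateGrowth_fourierChar_coe.comp (hasTemperateGrowth_archSdForm T).neg

/-- `|𝐞(-q_T(a))| = 1`. [folklore] -/
@[simp] theorem norm_archSdChar (T : Matrix (Fin n) (Fin n) (mixedSpace F)) (a : Fin n → mixedSpace F) :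
    ‖archSdChar F T a‖ = 1 :=
  Circle.norm_coe (𝐞 (-(archSdForm F T a)))

variable (F) in
/-- **Weil's `t(T)` at the archimedean places**: `Φ ↦ 𝐞(-q_T) Φ` as a continuous endomorphism of the
Schwartz space `𝓢((F ⊗ ℝ)ⁿ, ℂ)` (Mathlib `SchwartzMap.smulLeftCLM` for a multiplier of temperate growth).
[cite: Weil1964, Chap. I n° 34 p. 184] -/
def archSdCharCLM (T : Matrix (Fin n) (Fin n) (mixedSpace F)) :
    𝓢((Fin n → mixedSpace F), ℂ) →L[ℂ] 𝓢((Fin n → mixedSpace F), ℂ) :=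
  SchwartzMap.smulLeftCLM ℂ (archSdChar F T)

/-- Unfolding of `archSdCharCLM`: `(t(T)Φ)(a) = 𝐞(-q_T(a)) Φ(a)`. [folklore] -/
@[simp] theorem archSdCharCLM_apply (T : Matrix (Fin n) (Fin n) (mixedSpace F))
    (Φ : 𝓢((Fin n → mixedSpace F), ℂ)) (a : Fin n → mixedSpace F) :
    archSdCharCLM F T Φ a = archSdChar F T a * Φ a :=
  SchwartzMap.smulLeftCLM_apply_apply (hasTemperateGrowth_archSdChar T) Φ a

end Archimedean

/-! ### The finite second-degree characters `b ↦ ψ_f((bT)·b)` on `(𝔸_F^∞)ⁿ` -/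

section Finite

variable (F : Type) [Field F] [NumberField F] {n : ℕ}

/-- **`ψ_f` is locally constant**: it is constant on every coset of the open subring `𝒪̂_F = ∏_v 𝒪_v`, on
which it is trivial (`finiteAdeleAddChar_eq_one_of_forall_mem`, `isOpen_integralFiniteAdeles`). [folklore] -/
theorem isLocallyConstant_finiteAdeleAddChar :
    IsLocallyConstant (fun b : FiniteAdeleRing (𝓞 F) F => (finiteAdeleAddChar F b : ℂ)) := by
  refine (IsLocallyConstant.iff_exists_open _).2 fun b₀ => ?_
  refine ⟨{b | b - b₀ ∈ (integralFiniteAdeles F : Set (FiniteAdeleRing (𝓞 F) F))},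
    (isOpen_integralFiniteAdeles F).preimage (continuous_id.sub continuous_const), ?_, fun b hb => ?_⟩
  · show b₀ - b₀ ∈ (integralFiniteAdeles F : Set (FiniteAdeleRing (𝓞 F) F))
    rw [sub_self]
    exact zero_mem _
  · have h1 : finiteAdeleAddChar F (b - b₀) = 1 :=
      finiteAdeleAddChar_eq_one_of_forall_mem F (b := b - b₀) fun v => hb v
    have hb' : b = b₀ + (b - b₀) := by abel
    rw [hb', AddChar.map_add_eq_mul, h1, mul_one]

variable {F}

/-- The finite **second-degree form** `q_T(b) = (bT)·b = Σ_{i,j} b_j T_{ji} b_i` of `T ∈ M_n(𝔸_F^∞)`.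
[folklore] -/
def finSdForm (T : Matrix (Fin n) (Fin n) (FiniteAdeleRing (𝓞 F) F))
    (b : Fin n → FiniteAdeleRing (𝓞 F) F) : FiniteAdeleRing (𝓞 F) F :=
  (b ᵥ* T) ⬝ᵥ b

/-- Unfolding of `finSdForm`. [folklore] -/
theorem finSdForm_apply (T : Matrix (Fin n) (Fin n) (FiniteAdeleRing (𝓞 F) F))
    (b : Fin n → FiniteAdeleRing (𝓞 F) F) : finSdForm T b = (b ᵥ* T) ⬝ᵥ b := rfl

/-- `q_T` is continuous (a polynomial map). [folklore] -/
theorem continuous_finSdForm (T : Matrix (Fin n) (Fin n) (FiniteAdeleRing (𝓞 F) F)) :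
    Continuous (finSdForm T) :=
  (continuous_id.matrix_vecMul continuous_const).dotProduct continuous_id

/-- The finite **second-degree character** `b ↦ ψ_f(q_T(b))`. [folklore] -/
def finSdChar (T : Matrix (Fin n) (Fin n) (FiniteAdeleRing (𝓞 F) F))
    (b : Fin n → FiniteAdeleRing (𝓞 F) F) : ℂ :=
  (finiteAdeleAddChar F (finSdForm T b) : ℂ)

/-- Unfolding of `finSdChar`. [folklore] -/
theorem finSdChar_apply (T : Matrix (Fin n) (Fin n) (FiniteAdeleRing (𝓞 F) F))
    (b : Fin n → FiniteAdeleRing (𝓞 F) F) :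
    finSdChar T b = (finiteAdeleAddChar F ((b ᵥ* T) ⬝ᵥ b) : ℂ) := rfl

/-- **The finite second-degree characters are locally constant.** [folklore] -/
theorem isLocallyConstant_finSdChar (T : Matrix (Fin n) (Fin n) (FiniteAdeleRing (𝓞 F) F)) :
    IsLocallyConstant (finSdChar T) :=
  (isLocallyConstant_finiteAdeleAddChar F).comp_continuous (continuous_finSdForm T)

/-- `|ψ_f(q_T(b))| = 1`. [folklore] -/
@[simp] theorem norm_finSdChar (T : Matrix (Fin n) (Fin n) (FiniteAdeleRing (𝓞 F) F))
    (b : Fin n → FiniteAdeleRing (𝓞 F) F) : ‖finSdChar T b‖ = 1 :=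
  Circle.norm_coe (finiteAdeleAddChar F (finSdForm T b))

/-- **Weil's `t(T)` at the finite places preserves the Schwartz–Bruhat space of `(𝔸_F^∞)ⁿ`**: the product of a
locally constant function with a locally constant compactly supported one is again such.
[cite: Weil1964, Chap. I n° 34 p. 184] -/
theorem finSdChar_mul_mem_schwartzBruhat (T : Matrix (Fin n) (Fin n) (FiniteAdeleRing (𝓞 F) F))
    {Φf : (Fin n → FiniteAdeleRing (𝓞 F) F) → ℂ} (hΦ : Φf ∈ SchwartzBruhat (Fin n → FiniteAdeleRing (𝓞 F) F)) :
    (fun b => finSdChar T b * Φf b) ∈ SchwartzBruhat (Fin n → FiniteAdeleRing (𝓞 F) F) := by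
  obtain ⟨hlc, hcs⟩ := (mem_schwartzBruhat_iff).1 hΦ
  exact (mem_schwartzBruhat_iff).2 ⟨(isLocallyConstant_finSdChar T).mul hlc, hcs.mul_left⟩

end Finite

/-! ### The adelic second-degree characters `x ↦ ψ_F((xS)·x)` and the operators `t(S)` on `𝒮(𝔸_Fⁿ)` -/

section Global

variable (F : Type) [Field F] [NumberField F] {n : ℕ}

/-- The adelic **second-degree form** `q_S(x) = (xS)·x = Σ_{i,j} x_j S_{ji} x_i` of `S ∈ M_n(𝔸_F)`. [folklore] -/
def sdForm (S : Matrix (Fin n) (Fin n) (AdeleRing (𝓞 F) F)) (x : Fin n → AdeleRing (𝓞 F) F) :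
    AdeleRing (𝓞 F) F :=
  (x ᵥ* S) ⬝ᵥ x

/-- **The adelic second-degree character** `x ↦ ψ_F(q_S(x))` of `𝔸_Fⁿ` attached to `S ∈ M_n(𝔸_F)`
(`ψ_F = adeleAddChar F`, Tate's standard character). [cite: Weil1964, Chap. I n° 2 p. 146] -/
def sdChar (S : Matrix (Fin n) (Fin n) (AdeleRing (𝓞 F) F)) (x : Fin n → AdeleRing (𝓞 F) F) : ℂ :=
  (adeleAddChar F (sdForm F S x) : ℂ)

variable {F}

/-- Unfolding of `sdForm`. [folklore] -/
theorem sdForm_apply (S : Matrix (Fin n) (Fin n) (AdeleRing (𝓞 F) F)) (x : Fin n → AdeleRing (𝓞 F) F) :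
    sdForm F S x = (x ᵥ* S) ⬝ᵥ x := rfl

/-- Unfolding of `sdChar`. [folklore] -/
theorem sdChar_apply (S : Matrix (Fin n) (Fin n) (AdeleRing (𝓞 F) F)) (x : Fin n → AdeleRing (𝓞 F) F) :
    sdChar F S x = (adeleAddChar F ((x ᵥ* S) ⬝ᵥ x) : ℂ) := rfl

/-- `|ψ_F(q_S(x))| = 1`. [folklore] -/
@[simp] theorem norm_sdChar (S : Matrix (Fin n) (Fin n) (AdeleRing (𝓞 F) F)) (x : Fin n → AdeleRing (𝓞 F) F) :
    ‖sdChar F S x‖ = 1 :=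
  Circle.norm_coe (adeleAddChar F (sdForm F S x))

/-- `ψ_F(q_S(x)) ≠ 0`. [folklore] -/
theorem sdChar_ne_zero (S : Matrix (Fin n) (Fin n) (AdeleRing (𝓞 F) F)) (x : Fin n → AdeleRing (𝓞 F) F) :
    sdChar F S x ≠ 0 :=
  Circle.coe_ne_zero (adeleAddChar F (sdForm F S x))

/-- `q_S` is additive in `S`. [folklore] -/
theorem sdForm_add (S T : Matrix (Fin n) (Fin n) (AdeleRing (𝓞 F) F)) (x : Fin n → AdeleRing (𝓞 F) F) :
    sdForm F (S + T) x = sdForm F S x + sdForm F T x := by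
  rw [sdForm, sdForm, sdForm, Matrix.vecMul_add, add_dotProduct]

/-- `q_0 = 0`. [folklore] -/
@[simp] theorem sdForm_zero (x : Fin n → AdeleRing (𝓞 F) F) :
    sdForm F (0 : Matrix (Fin n) (Fin n) (AdeleRing (𝓞 F) F)) x = 0 := by
  rw [sdForm, Matrix.vecMul_zero, zero_dotProduct]

/-- **`S ↦ ψ_F(q_S(x))` is a character of the additive group `M_n(𝔸_F)`.** [folklore] -/
theorem sdChar_add (S T : Matrix (Fin n) (Fin n) (AdeleRing (𝓞 F) F)) (x : Fin n → AdeleRing (𝓞 F) F) :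
    sdChar F (S + T) x = sdChar F S x * sdChar F T x := by
  rw [sdChar, sdChar, sdChar, sdForm_add, AddChar.map_add_eq_mul, Circle.coe_mul]

/-- `ψ_F(q_0(x)) = 1`. [folklore] -/
@[simp] theorem sdChar_zero (x : Fin n → AdeleRing (𝓞 F) F) :
    sdChar F (0 : Matrix (Fin n) (Fin n) (AdeleRing (𝓞 F) F)) x = 1 := by
  rw [sdChar, sdForm_zero, AddChar.map_zero_eq_one, Circle.coe_one]

/-- `ψ_F(q_{-S}(x)) ψ_F(q_S(x)) = 1`. [folklore] -/
theorem sdChar_neg_mul (S : Matrix (Fin n) (Fin n) (AdeleRing (𝓞 F) F)) (x : Fin n → AdeleRing (𝓞 F) F) :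
    sdChar F (-S) x * sdChar F S x = 1 := by
  rw [← sdChar_add, neg_add_cancel, sdChar_zero]

/-- **`q_S(xg) = q_{gSgᵀ}(x)`** (`(xg)S·(xg) = x(gSgᵀ)·x`). [folklore] -/
theorem sdForm_vecMul (S g : Matrix (Fin n) (Fin n) (AdeleRing (𝓞 F) F)) (x : Fin n → AdeleRing (𝓞 F) F) :
    sdForm F S (x ᵥ* g) = sdForm F (g * S * gᵀ) x := by
  rw [sdForm, sdForm, Matrix.vecMul_vecMul]
  have hx : x ᵥ* g = gᵀ *ᵥ x := (Matrix.mulVec_transpose g x).symm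
  rw [hx, Matrix.dotProduct_mulVec, Matrix.vecMul_vecMul]

/-- `ψ_F(q_S(xg)) = ψ_F(q_{gSgᵀ}(x))`. [folklore] -/
theorem sdChar_vecMul (S g : Matrix (Fin n) (Fin n) (AdeleRing (𝓞 F) F)) (x : Fin n → AdeleRing (𝓞 F) F) :
    sdChar F S (x ᵥ* g) = sdChar F (g * S * gᵀ) x := by
  rw [sdChar, sdChar, sdForm_vecMul]

/-- **The adelic second-degree character splits along `𝔸_Fⁿ ≅ (F ⊗ ℝ)ⁿ × (𝔸_F^∞)ⁿ`**: on `x = (a, b)`,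
`ψ_F(q_S(x)) = 𝐞(-⟨a, a S_∞⟩) · ψ_f((b S_f)·b)` (the tree's `adeleAddChar_sum_mul_piAdeleSplit`). [folklore] -/
theorem sdChar_piAdeleSplit (S : Matrix (Fin n) (Fin n) (AdeleRing (𝓞 F) F))
    (p : (Fin n → mixedSpace F) × (Fin n → FiniteAdeleRing (𝓞 F) F)) :
    sdChar F S (piAdeleSplit F (Fin n) p) =
      archSdChar F (S.map (archHom F)) p.1 *
        finSdChar (S.map (RingHom.snd (InfiniteAdeleRing F) (FiniteAdeleRing (𝓞 F) F))) p.2 := by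
  rw [sdChar, sdForm, dotProduct, adeleAddChar_sum_mul_piAdeleSplit, piArch_vecMul, piArch_piAdeleSplit,
    piFinite_vecMul, piFinite_piAdeleSplit]
  rfl

/-- The same in the coordinates `piArch`, `piFinite` of a vector `x ∈ 𝔸_Fⁿ`. [folklore] -/
theorem sdChar_eq_mul (S : Matrix (Fin n) (Fin n) (AdeleRing (𝓞 F) F)) (x : Fin n → AdeleRing (𝓞 F) F) :
    sdChar F S x =
      archSdChar F (S.map (archHom F)) (piArch F (Fin n) x) *
        finSdChar (S.map (RingHom.snd (InfiniteAdeleRing F) (FiniteAdeleRing (𝓞 F) F))) (piFinite F (Fin n) x) := by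
  have h := sdChar_piAdeleSplit S ((piAdeleSplit F (Fin n)).symm x)
  rw [ContinuousAddEquiv.apply_symm_apply] at h
  exact h

variable (F) in
/-- **Weil's operator `t(S)`**: multiplication by the second-degree character, `(t(S)Φ)(x) = ψ_F(q_S(x)) Φ(x)`,
on functions `𝔸_Fⁿ → ℂ`. [cite: Weil1964, Chap. I n° 34 p. 184] -/
def chirp (S : Matrix (Fin n) (Fin n) (AdeleRing (𝓞 F) F)) (Φ : (Fin n → AdeleRing (𝓞 F) F) → ℂ) :
    (Fin n → AdeleRing (𝓞 F) F) → ℂ :=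
  fun x => sdChar F S x * Φ x

/-- Unfolding of `chirp`. [folklore] -/
@[simp] theorem chirp_apply (S : Matrix (Fin n) (Fin n) (AdeleRing (𝓞 F) F))
    (Φ : (Fin n → AdeleRing (𝓞 F) F) → ℂ) (x : Fin n → AdeleRing (𝓞 F) F) :
    chirp F S Φ x = sdChar F S x * Φ x := rfl

/-- `t(0) = id`. [folklore] -/
@[simp] theorem chirp_zero_matrix (Φ : (Fin n → AdeleRing (𝓞 F) F) → ℂ) :
    chirp F (0 : Matrix (Fin n) (Fin n) (AdeleRing (𝓞 F) F)) Φ = Φ := by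
  funext x
  rw [chirp_apply, sdChar_zero, one_mul]

/-- **`t(S + T) = t(S) t(T)`** (one-parameter law). [folklore] -/
theorem chirp_add_matrix (S T : Matrix (Fin n) (Fin n) (AdeleRing (𝓞 F) F))
    (Φ : (Fin n → AdeleRing (𝓞 F) F) → ℂ) : chirp F (S + T) Φ = chirp F S (chirp F T Φ) := by
  funext x
  rw [chirp_apply, chirp_apply, chirp_apply, sdChar_add, mul_assoc]

/-- `t(S)` and `t(T)` commute. [folklore] -/
theorem chirp_comm (S T : Matrix (Fin n) (Fin n) (AdeleRing (𝓞 F) F))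
    (Φ : (Fin n → AdeleRing (𝓞 F) F) → ℂ) : chirp F S (chirp F T Φ) = chirp F T (chirp F S Φ) := by
  rw [← chirp_add_matrix, add_comm, chirp_add_matrix]

/-- `t(-S) t(S) = id`. [folklore] -/
theorem chirp_neg_chirp (S : Matrix (Fin n) (Fin n) (AdeleRing (𝓞 F) F))
    (Φ : (Fin n → AdeleRing (𝓞 F) F) → ℂ) : chirp F (-S) (chirp F S Φ) = Φ := by
  rw [← chirp_add_matrix, neg_add_cancel, chirp_zero_matrix]

/-- `t(S)` is additive in `Φ`. [folklore] -/
theorem chirp_add (S : Matrix (Fin n) (Fin n) (AdeleRing (𝓞 F) F)) (Φ Ψ : (Fin n → AdeleRing (𝓞 F) F) → ℂ) :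
    chirp F S (Φ + Ψ) = chirp F S Φ + chirp F S Ψ := by
  funext x
  simp only [chirp_apply, Pi.add_apply, mul_add]

/-- `t(S)` is homogeneous in `Φ`. [folklore] -/
theorem chirp_smul (S : Matrix (Fin n) (Fin n) (AdeleRing (𝓞 F) F)) (a : ℂ) (Φ : (Fin n → AdeleRing (𝓞 F) F) → ℂ) :
    chirp F S (a • Φ) = a • chirp F S Φ := by
  funext x
  simp only [chirp_apply, Pi.smul_apply, smul_eq_mul, mul_left_comm]

/-- `t(S) 0 = 0`. [folklore] -/
@[simp] theorem chirp_zero (S : Matrix (Fin n) (Fin n) (AdeleRing (𝓞 F) F)) :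
    chirp F S (0 : (Fin n → AdeleRing (𝓞 F) F) → ℂ) = 0 := by
  funext x
  simp only [chirp_apply, Pi.zero_apply, mul_zero]

/-- **`t(S)` is pointwise isometric**: `|(t(S)Φ)(x)| = |Φ(x)|`. [folklore] -/
@[simp] theorem norm_chirp_apply (S : Matrix (Fin n) (Fin n) (AdeleRing (𝓞 F) F))
    (Φ : (Fin n → AdeleRing (𝓞 F) F) → ℂ) (x : Fin n → AdeleRing (𝓞 F) F) : ‖chirp F S Φ x‖ = ‖Φ x‖ := by
  rw [chirp_apply, norm_mul, norm_sdChar, one_mul]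

/-- **WEIL'S RELATION `d(g)⁻¹ t(S) d(g) = t(gSgᵀ)`** between the twists `Φ ↦ Φ(· g)` of F1 and the operators
`t(S)`: `(t(S)Φ)(· g) = t(gSgᵀ)(Φ(· g))`. [cite: Weil1964, Chap. I n° 34 p. 182–184] -/
theorem twist_chirp (g : GL (Fin n) (AdeleRing (𝓞 F) F)) (S : Matrix (Fin n) (Fin n) (AdeleRing (𝓞 F) F))
    (Φ : (Fin n → AdeleRing (𝓞 F) F) → ℂ) :
    twist F g (chirp F S Φ) =
      chirp F ((g : Matrix (Fin n) (Fin n) (AdeleRing (𝓞 F) F)) * S *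
          (g : Matrix (Fin n) (Fin n) (AdeleRing (𝓞 F) F))ᵀ) (twist F g Φ) := by
  funext x
  rw [twist_apply, chirp_apply, chirp_apply, twist_apply, sdChar_vecMul]

/-- A factorizable Schwartz–Bruhat function times a second-degree character is factorizable Schwartz–Bruhat
(`archSdCharCLM` on the archimedean factor, `finSdChar_mul_mem_schwartzBruhat` on the finite one). [folklore] -/
theorem isFactorizablePiSchwartzBruhat_chirp {Φ : (Fin n → AdeleRing (𝓞 F) F) → ℂ}
    (h : IsFactorizablePiSchwartzBruhat F (Fin n) Φ) (S : Matrix (Fin n) (Fin n) (AdeleRing (𝓞 F) F)) :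
    IsFactorizablePiSchwartzBruhat F (Fin n) (chirp F S Φ) := by
  obtain ⟨Φinf, Φfin, hfin, rfl⟩ := h
  refine ⟨archSdCharCLM F (S.map (archHom F)) Φinf,
    fun b => finSdChar (S.map (RingHom.snd (InfiniteAdeleRing F) (FiniteAdeleRing (𝓞 F) F))) b * Φfin b,
    finSdChar_mul_mem_schwartzBruhat _ hfin, funext fun x => ?_⟩
  rw [chirp_apply, archSdCharCLM_apply, sdChar_eq_mul]
  ring

/-- **`𝒮(𝔸_Fⁿ)` IS STABLE UNDER WEIL'S `t(S)`**, `S ∈ M_n(𝔸_F)` ([Weil1964, n° 34]: `t(f)` maps `𝒮(X_A)` to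
itself; here for the tree's `piSchwartzBruhat`, by span induction from the factorizable case).
[cite: Weil1964, Chap. I n° 34 p. 184] -/
theorem chirp_mem {Φ : (Fin n → AdeleRing (𝓞 F) F) → ℂ} (hΦ : Φ ∈ piSchwartzBruhat F (Fin n))
    (S : Matrix (Fin n) (Fin n) (AdeleRing (𝓞 F) F)) : chirp F S Φ ∈ piSchwartzBruhat F (Fin n) := by
  induction hΦ using Submodule.span_induction with
  | mem Φ h => exact mem_piSchwartzBruhat (isFactorizablePiSchwartzBruhat_chirp h S)
  | zero =>
    rw [chirp_zero]
    exact zero_mem _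
  | add Φ Ψ _ _ ihΦ ihΨ =>
    rw [chirp_add]
    exact add_mem ihΦ ihΨ
  | smul c Φ _ ih =>
    rw [chirp_smul]
    exact Submodule.smul_mem _ c ih

variable (F) in
/-- **Weil's `t(S)` as a linear endomorphism of `𝒮(𝔸_Fⁿ)`.** [cite: Weil1964, Chap. I n° 34 p. 184] -/
def chirpLM (S : Matrix (Fin n) (Fin n) (AdeleRing (𝓞 F) F)) :
    piSchwartzBruhat F (Fin n) →ₗ[ℂ] piSchwartzBruhat F (Fin n) where
  toFun Φ := ⟨chirp F S (Φ : (Fin n → AdeleRing (𝓞 F) F) → ℂ), chirp_mem Φ.2 S⟩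
  map_add' Φ Ψ := by
    ext x
    simp only [Submodule.coe_add, chirp_add, Pi.add_apply]
  map_smul' a Φ := by
    ext x
    simp only [Submodule.coe_smul, chirp_smul, Pi.smul_apply, RingHom.id_apply]

/-- Unfolding of `chirpLM` on underlying functions. [folklore] -/
@[simp] theorem coe_chirpLM (S : Matrix (Fin n) (Fin n) (AdeleRing (𝓞 F) F)) (Φ : piSchwartzBruhat F (Fin n)) :
    ((chirpLM F S Φ : piSchwartzBruhat F (Fin n)) : (Fin n → AdeleRing (𝓞 F) F) → ℂ) =
      chirp F S (Φ : (Fin n → AdeleRing (𝓞 F) F) → ℂ) := rfl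

/-- `chirpLM 0 = 1`. [folklore] -/
theorem chirpLM_zero : chirpLM F (0 : Matrix (Fin n) (Fin n) (AdeleRing (𝓞 F) F)) = 1 := by
  ext Φ x
  simp only [coe_chirpLM, chirp_zero_matrix, Module.End.one_apply]

/-- **`t(S + T) = t(S) t(T)`** for the packaged operators. [folklore] -/
theorem chirpLM_add (S T : Matrix (Fin n) (Fin n) (AdeleRing (𝓞 F) F)) :
    chirpLM F (S + T) = chirpLM F S * chirpLM F T := by
  ext Φ x
  simp only [coe_chirpLM, chirp_add_matrix, Module.End.mul_apply]

variable (F n) in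
/-- **The representation `S ↦ t(S)` of the additive group `M_n(𝔸_F)`** (written multiplicatively) on
`𝒮(𝔸_Fⁿ)`. [cite: Weil1964, Chap. I n° 34 p. 184] -/
def chirpRep : Multiplicative (Matrix (Fin n) (Fin n) (AdeleRing (𝓞 F) F)) →* Module.End ℂ (piSchwartzBruhat F (Fin n)) where
  toFun S := chirpLM F S.toAdd
  map_one' := chirpLM_zero
  map_mul' S T := by
    rw [toAdd_mul, chirpLM_add]

/-- Unfolding of `chirpRep`. [folklore] -/
@[simp] theorem chirpRep_apply (S : Multiplicative (Matrix (Fin n) (Fin n) (AdeleRing (𝓞 F) F))) :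
    chirpRep F n S = chirpLM F S.toAdd := rfl

variable (F n) in
/-- The same representation with values in the GROUP of invertible linear operators of `𝒮(𝔸_Fⁿ)`. [folklore] -/
def chirpUnit : Multiplicative (Matrix (Fin n) (Fin n) (AdeleRing (𝓞 F) F)) →*
    (Module.End ℂ (piSchwartzBruhat F (Fin n)))ˣ :=
  (chirpRep F n).toHomUnits

/-- Unfolding of `chirpUnit`. [folklore] -/
@[simp] theorem coe_chirpUnit (S : Multiplicative (Matrix (Fin n) (Fin n) (AdeleRing (𝓞 F) F))) :
    ((chirpUnit F n S : (Module.End ℂ (piSchwartzBruhat F (Fin n)))ˣ) :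
      Module.End ℂ (piSchwartzBruhat F (Fin n))) = chirpLM F S.toAdd := rfl

end Global

/-! ### Rational second-degree characters stabilise `Θ` -/

section Rational

variable (F : Type) [Field F] [NumberField F] {n : ℕ}

/-- The rational points `M_n(F) → M_n(𝔸_F)` (entrywise `algebraMap`). [folklore] -/
abbrev ratMatrix (σ : Matrix (Fin n) (Fin n) F) : Matrix (Fin n) (Fin n) (AdeleRing (𝓞 F) F) :=
  σ.map (algebraMap F (AdeleRing (𝓞 F) F))

variable {F}

/-- `q_σ(ξ) ∈ F` for rational `σ` and `ξ`: `q_{σ}(ratPt ξ) = ((ξσ)·ξ : F)` as a principal adele. [folklore] -/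
theorem sdForm_ratMatrix_ratPt (σ : Matrix (Fin n) (Fin n) F) (ξ : Fin n → F) :
    sdForm F (ratMatrix F σ) (ratPt F (Fin n) ξ) =
      algebraMap F (AdeleRing (𝓞 F) F) ((ξ ᵥ* σ) ⬝ᵥ ξ) := by
  rw [sdForm, RingHom.map_dotProduct]
  have hv : ratPt F (Fin n) ξ ᵥ* ratMatrix F σ = algebraMap F (AdeleRing (𝓞 F) F) ∘ (ξ ᵥ* σ) := by
    funext i
    exact (RingHom.map_vecMul (algebraMap F (AdeleRing (𝓞 F) F)) σ ξ i).symm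
  rw [hv]
  rfl

/-- **`ψ_F(q_σ(ξ)) = 1` for rational `σ ∈ M_n(F)`, `ξ ∈ Fⁿ`** (`ψ_F` is trivial on the principal adeles,
`adeleAddChar_algebraMap`). [folklore] -/
theorem sdChar_ratMatrix_ratPt (σ : Matrix (Fin n) (Fin n) F) (ξ : Fin n → F) :
    sdChar F (ratMatrix F σ) (ratPt F (Fin n) ξ) = 1 := by
  rw [sdChar, sdForm_ratMatrix_ratPt, adeleAddChar_algebraMap, Circle.coe_one]

/-- `(t(σ)Φ)(ξ) = Φ(ξ)` at rational points. [folklore] -/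
theorem chirp_ratMatrix_ratPt (σ : Matrix (Fin n) (Fin n) F) (Φ : (Fin n → AdeleRing (𝓞 F) F) → ℂ)
    (ξ : Fin n → F) : chirp F (ratMatrix F σ) Φ (ratPt F (Fin n) ξ) = Φ (ratPt F (Fin n) ξ) := by
  rw [chirp_apply, sdChar_ratMatrix_ratPt, one_mul]

/-- **Invariance of `Θ` under the rational second-degree characters**: `Θ(t(σ)Φ) = Θ(Φ)` for `σ ∈ M_n(F)`
and EVERY `Φ : 𝔸_Fⁿ → ℂ` (termwise equality of the series; no convergence needed) — the `t(σ)`-case of the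
invariance half of [Weil1964, Thm 6] in the concrete model. [cite: Weil1964, Chap. III n° 41, (39) and Thm 6 p. 193] -/
theorem thetaDist_chirp_ratMatrix (σ : Matrix (Fin n) (Fin n) F) (Φ : (Fin n → AdeleRing (𝓞 F) F) → ℂ) :
    thetaDist F (Fin n) (chirp F (ratMatrix F σ) Φ) = thetaDist F (Fin n) Φ := by
  simp only [thetaDist]
  exact tsum_congr fun ξ => chirp_ratMatrix_ratPt σ Φ ξ

/-- The same for the packaged operator `chirpLM`. [folklore] -/
theorem thetaDistLM_chirpLM_ratMatrix (σ : Matrix (Fin n) (Fin n) F) (Φ : piSchwartzBruhat F (Fin n)) :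
    thetaDistLM F (Fin n) (chirpLM F (ratMatrix F σ) Φ) = thetaDistLM F (Fin n) Φ := by
  rw [thetaDistLM_apply, coe_chirpLM, thetaDist_chirp_ratMatrix, thetaDistLM_apply]

/-- **`θ_{t(σ)Φ}` at a rational translate**: `θ_{t(σ)Φ}(ratPt η) = θ_Φ(ratPt η)` (`η ∈ Fⁿ`). [folklore] -/
theorem thetaFun_chirp_ratMatrix_ratPt (σ : Matrix (Fin n) (Fin n) F) (Φ : (Fin n → AdeleRing (𝓞 F) F) → ℂ)
    (η : Fin n → F) :
    thetaFun F (Fin n) (chirp F (ratMatrix F σ) Φ) (ratPt F (Fin n) η) = thetaFun F (Fin n) Φ (ratPt F (Fin n) η) := by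
  rw [thetaFun_ratPt, thetaFun_ratPt, thetaDist_chirp_ratMatrix]

/-- **THE RATIONAL SECOND-DEGREE CHARACTERS LIE IN THE STABILISER OF `Θ`** (`rat` of the concrete
`WeilThetaDatum` of `AdelicThetaDistribution.lean`). [cite: Weil1964, Chap. III n° 41, Thm 6 p. 193] -/
theorem chirpUnit_ratMatrix_mem_thetaStabilizer (σ : Matrix (Fin n) (Fin n) F) :
    chirpUnit F n (Multiplicative.ofAdd (ratMatrix F σ)) ∈ thetaStabilizer F (Fin n) := fun Φ => by
  rw [coe_chirpUnit, toAdd_ofAdd]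
  exact thetaDistLM_chirpLM_ratMatrix σ Φ

/-- **`Θ_Φ(t(σ) S) = Θ_Φ(S)`** through the packaged datum: the invariance conjunct of Théorème 6 for the
generators `t(σ)`, `σ ∈ M_n(F)`. [cite: Weil1964, Chap. III n° 41, Thm 6 p. 193] -/
theorem schwartzBruhatWeilThetaDatum_theta_chirp_ratMatrix (σ : Matrix (Fin n) (Fin n) F)
    (Φ : piSchwartzBruhat F (Fin n)) (S : (Module.End ℂ (piSchwartzBruhat F (Fin n)))ˣ) :
    (schwartzBruhatWeilThetaDatum F (Fin n)).theta Φ (chirpUnit F n (Multiplicative.ofAdd (ratMatrix F σ)) * S) =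
      (schwartzBruhatWeilThetaDatum F (Fin n)).theta Φ S :=
  schwartzBruhatWeilThetaDatum_theta_invariant Φ _ (chirpUnit_ratMatrix_mem_thetaStabilizer σ) S

/-- The subgroup of `(End 𝒮(𝔸_Fⁿ))ˣ` generated by the rational twists `d(γ)`, `γ ∈ GL_n(F)`, and the rational
second-degree characters `t(σ)`, `σ ∈ M_n(F)` — the image of the rational points of Weil's group generated
by `d` and `t` — is contained in the stabiliser of `Θ`. [cite: Weil1964, Chap. III n° 41, Thm 6 p. 193] -/
theorem closure_ratGL_ratMatrix_le_thetaStabilizer :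
    Subgroup.closure
        ((Set.range fun γ : GL (Fin n) F => twistUnit F n (ratGL F γ)) ∪
          Set.range fun σ : Matrix (Fin n) (Fin n) F => chirpUnit F n (Multiplicative.ofAdd (ratMatrix F σ))) ≤
      thetaStabilizer F (Fin n) := by
  rw [Subgroup.closure_le]
  rintro S (⟨γ, rfl⟩ | ⟨σ, rfl⟩)
  · exact twistUnit_ratGL_mem_thetaStabilizer γ
  · exact chirpUnit_ratMatrix_mem_thetaStabilizer σ

end Rational

end Literature.NumberTheory.Weil1964

end
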